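import Summits.BirchSwinnertonDyer.BirchSwinnertonDyer.Theorems.ManinLocalTwoThreeKummerTriplingSeries
import HarnessLib

/-!
# The Kummer tripling identity on the formal group over an ARBITRARY field with a marked subring of «integral» constants
(route `ManinLocalTwoThree`, crux C3 `ManinPrimeToThreeAtNine` stmt-BirchSwinnertonDyer-22968 — residual RES₃♭, -an g39's `K`-line, stub (BI)_K
`UDCKummerLineK.KummerCubeRootThreeBoundedK` of the C3 LEAD's skeleton v29; cell bsd-f2-manin, prover seat p2 gen 18; `--supports stmt-BirchSwinnertonDyer-22968`)

The ℚ-line's (BI) (`KummerCubeRootBounded.kummerCubeRoot_threeAdicallyBounded`, p3 g15) rests on E-an-55 `ManinThreeKummerCube_holds`, whose engine is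
`kummerTripling_padic` (this namespace, file `…KummerTriplingSeries`): for `V/ℤ_p` with elliptic generic fibre, a `3`-torsion point `T = (X₁, Y₁) ∈ E(ℚ_p)`
and a `p`-integral parameter `s`, the pole-cleared tangent-line Kummer series `Θ` of `T` along `D = [3](s)` satisfies `Θ·B³ = A³` with `A, B ∈ ℤ_p⟦X⟧`.
That statement is hard-wired to `ℚ_p`/`ℤ_p`/`IsPadicInt`.  The `K`-line's (BI)_K (a `K`-RATIONAL point of order `3`, `K = ℚ(√r)`) needs the SAME
identity over a finite extension `k` of `ℚ₃` with integrality measured in a subring `S ⊆ k` (the valuation ring of `k`) — see p2's Edison census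
(STATUS 2026-08-29T17:5xZ).  This file provides the GENERIC, reusable layer:

* §1 integrality of power series in a SUBRING `S ≤ k`: the subring `(PowerSeries.map S.subtype).range ≤ k⟦X⟧` («`S⟦X⟧`»): membership is
  coefficientwise (`mem_rangeS_iff_coeff`), it is closed under substitution (`subst_mem_rangeS`), contains `C c` for `c ∈ S` and the images of
  `ℤ_p`-series under any `φ : ℤ_p →+* k` with `φ(ℤ_p) ⊆ S` — the `IsPadicInt` API of `Literature…PadicSeriesEvaluation` with `ℤ_p ⊂ ℚ_p` replaced by `S ⊂ k`;
* §2 **`kummerTripling_of_subring`** — `kummerTripling_padic` RE-RUN VERBATIM for `V/ℤ_p`, ANY field `k` of characteristic `≠ 2` receiving `ℤ_p`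
  (`φ : ℤ_p →+* k`; the tree's `laurentPt_formalMul` is already stated in this generality), ANY subring `S ∋ φ(ℤ_p)`, a `3`-torsion point `(X₁, Y₁) ∈ E(k)`,
  an `S`-integral parameter `s`, and a scaling constant `μ ∈ S ∖ 0` with `μX₁, μY₁, μλ ∈ S` (over `ℚ_p`: `μ = p^m`, `exists_norm_pow_mul_le_one₃`):
  `Θ·B³ = A³` with `A, B ∈ S⟦X⟧`, `B ≠ 0`.  The Kubert change, `laurentPt_formalMul`, `kubert_y_three_smul` and the bridging identities are untouched;
  only the integrality bookkeeping changes currency.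

HONEST FRAMING.  Infrastructure only: (BI)_K additionally needs (I3) a DVR/PID structure on the valuation ring of `k = ℚ₃(√r′)` (so that `S⟦X⟧` is a UFD:
`B³ ∣ (3ʲA)³ ⇒ B ∣ 3ʲA`, as in p3's (BI)) and (I4) the number-field bookkeeping `ℚ(Y₀) ↔ k`; neither is here.  (BI)_K, KLINE, RES₃♭, C3, Manin's conjecture and
BSD are NOT proved.  No sorry, no new axioms. [cite: SilvermanAEC2009, Prop. VII.2.2 and Exercise 3.7(d) (shape)] [cite: Knapp1993, §V.5 (5.28)]
-/

set_option autoImplicit false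
-- lint-debt: the directory name repeats the summit name (sibling precedent `ManinLocalTwoThreeKummerTriplingSeries.lean`)
set_option linter.dupNamespace false

noncomputable section

open scoped Classical LaurentSeries
open PowerSeries WeierstrassCurve Literature.NumberTheory.EllipticCurves

namespace Summit.BirchSwinnertonDyer.BirchSwinnertonDyer.Theorems.ManinLocalTwoThree

/-! ### §1 Power series with coefficients in a subring -/

section SubringSeries

variable {k : Type*} [Field k] (S : Subring k)

/-- `f ∈ S⟦X⟧ ⊆ k⟦X⟧` (the range of `PowerSeries.map S.subtype`) iff every coefficient of `f` lies in `S`. [folklore] -/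
theorem mem_rangeS_iff_coeff {f : k⟦X⟧} : f ∈ (PowerSeries.map S.subtype).range ↔ ∀ n, coeff n f ∈ S := by
  constructor
  · rintro ⟨g, rfl⟩ n
    rw [coeff_map]
    exact (coeff n g).2
  · intro h
    refine ⟨PowerSeries.mk fun n => ⟨coeff n f, h n⟩, ?_⟩
    ext n
    rw [coeff_map, coeff_mk]
    rfl

/-- Constants from `S` lie in `S⟦X⟧`. [folklore] -/
theorem C_mem_rangeS {c : k} (hc : c ∈ S) : (C c : k⟦X⟧) ∈ (PowerSeries.map S.subtype).range := by
  rw [mem_rangeS_iff_coeff]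
  intro n
  rw [coeff_C]
  split_ifs
  · exact hc
  · exact S.zero_mem

/-- A series mapped from a coefficient ring `O` along `φ : O →+* k` with `φ(O) ⊆ S` lies in `S⟦X⟧`. [folklore] -/
theorem map_mem_rangeS {O : Type*} [CommRing O] (φ : O →+* k) (hφ : ∀ x, φ x ∈ S) (G : O⟦X⟧) :
    PowerSeries.map φ G ∈ (PowerSeries.map S.subtype).range := by
  rw [mem_rangeS_iff_coeff]
  intro n
  rw [coeff_map]
  exact hφ _

/-- In `k⟦X⟧` (`k` a field) `HasSubst a` forces `a(0) = 0`. [folklore] -/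
theorem constantCoeff_eq_zero_of_hasSubst' {a : k⟦X⟧} (h : HasSubst a) : constantCoeff a = 0 :=
  IsNilpotent.eq_zero h

/-- **`S⟦X⟧` is closed under substitution**: `f.subst a ∈ S⟦X⟧` for `f, a ∈ S⟦X⟧` with `HasSubst a` (`PowerSeries.map_subst` along `S.subtype`). [folklore] -/
theorem subst_mem_rangeS {f a : k⟦X⟧} (hf : f ∈ (PowerSeries.map S.subtype).range) (ha : a ∈ (PowerSeries.map S.subtype).range)
    (h : HasSubst a) : f.subst a ∈ (PowerSeries.map S.subtype).range := by
  obtain ⟨g, rfl⟩ := hf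
  obtain ⟨b, rfl⟩ := ha
  have hb0 : constantCoeff b = 0 := by
    have h0 := constantCoeff_eq_zero_of_hasSubst' h
    rw [← coeff_zero_eq_constantCoeff, coeff_map, coeff_zero_eq_constantCoeff] at h0
    exact Subtype.ext h0
  have hb : HasSubst b := HasSubst.of_constantCoeff_zero' hb0
  refine ⟨g.subst b, ?_⟩
  change MvPowerSeries.map S.subtype (g.subst b) = _
  rw [PowerSeries.map_subst hb]
  rfl

end SubringSeries

/-! ### §2 The tripling identity over a field receiving `ℤ_p`, with integrality in a subring -/

section Main

variable {p : ℕ} [Fact p.Prime] (V : WeierstrassCurve ℤ_[p]) [hE : (V.map PadicInt.Coe.ringHom).IsElliptic]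
  {k : Type*} [Field k] (φ : ℤ_[p] →+* k) [hEk : (V.map φ).IsElliptic]

/-- **The Kummer tripling identity on the formal group, poles cleared, with witnesses integral in a subring** (`kummerTripling_padic` over an
arbitrary field `k ⊇ φ(ℤ_p)` of characteristic `≠ 2` and an arbitrary subring `S ∋ φ(ℤ_p)`): `V/ℤ_p` a Weierstrass equation with elliptic
generic fibre, `T = (X₁, Y₁) ∈ E(k)` nonsingular with `3 • T = O`, `λ` its tangent slope, `s ∈ XS⟦X⟧` nonzero with `D = [3](s) ≠ 0`, and `μ ∈ S ∖ 0`
with `μX₁, μY₁, μλ ∈ S`.  Then `Θ = −X(D) − Y₁D³ − λ(X(D)D − X₁D³)` satisfies `Θ·B³ = A³` for some `A, B ∈ S⟦X⟧`, `B ≠ 0`.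
[cite: SilvermanAEC2009, Prop. VII.2.2 and Exercise 3.7(d) (shape)] [cite: Knapp1993, §V.5 (5.28)] -/
theorem kummerTripling_of_subring (S : Subring k) (hφS : ∀ x, φ x ∈ S) (h2 : (2 : k) ≠ 0) {X₁ Y₁ : k}
    (hT : (V.map φ).toAffine.Nonsingular X₁ Y₁)
    (h3T : 3 • Affine.Point.some X₁ Y₁ hT = 0)
    {s : k⟦X⟧} (hs0 : constantCoeff s = 0) (hs : s ≠ 0) (hsint : s ∈ (PowerSeries.map S.subtype).range)
    (hD : ((V.map φ).formalMul 3).subst s ≠ 0)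
    {μ : k} (hμ0 : μ ≠ 0) (hμS : μ ∈ S) (hmX : μ * X₁ ∈ S) (hmY : μ * Y₁ ∈ S)
    (hmL : μ * (V.map φ).toAffine.slope X₁ X₁ Y₁ Y₁ ∈ S) :
    ∃ A B : k⟦X⟧, A ∈ (PowerSeries.map S.subtype).range ∧ B ∈ (PowerSeries.map S.subtype).range ∧ B ≠ 0 ∧
      (-(V.map φ).formalXMulSq.subst (((V.map φ).formalMul 3).subst s)
          - C Y₁ * ((V.map φ).formalMul 3).subst s ^ 3
          - C ((V.map φ).toAffine.slope X₁ X₁ Y₁ Y₁) *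
            ((V.map φ).formalXMulSq.subst (((V.map φ).formalMul 3).subst s) * ((V.map φ).formalMul 3).subst s
              - C X₁ * ((V.map φ).formalMul 3).subst s ^ 3)) * B ^ 3 = A ^ 3 := by
  -- adapted from `kummerTripling_padic` (this namespace; `ℚ_p ↦ k`, `IsPadicInt ↦ ∈ S⟦X⟧`)
  set R : Subring k⟦X⟧ := (PowerSeries.map S.subtype).range with hR
  set lam := (V.map φ).toAffine.slope X₁ X₁ Y₁ Y₁ with hlam
  set D := ((V.map φ).formalMul 3).subst s with hDdef
  have hD0 : constantCoeff D = 0 := by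
    rw [hDdef, Literature.RingTheory.FormalGroups.constantCoeff_subst_of_constantCoeff_eq_zero hs0,
      (V.map φ).constantCoeff_formalMul]
  -- §a/§b the scaled Kubert change over `k` and over `K = k⸨X⸩`
  set uμ : kˣ := (Units.mk0 μ hμ0)⁻¹ with huμ
  have huinv : ((uμ⁻¹ : kˣ) : k) = μ := by rw [huμ, inv_inv, Units.val_mk0]
  set a₁' : k := μ * ((V.map φ).a₁ + 2 * lam) with ha₁'
  set a₃' : k := μ ^ 3 * (2 * Y₁ + (V.map φ).a₁ * X₁ + (V.map φ).a₃) with ha₃'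
  have hC₀E : (⟨uμ, X₁, lam, Y₁⟩ : VariableChange k) • (V.map φ) = kubertThree a₁' a₃' := by
    have h := smul_eq_kubertThree_of_three_nsmul (V.map φ) uμ hT h3T
    rwa [← hlam, huinv] at h
  set ι : k →+* k⸨X⸩ := algebraMap k k⸨X⸩ with hι
  set CK : VariableChange k⸨X⸩ := (⟨uμ, X₁, lam, Y₁⟩ : VariableChange k).map ι with hCK
  have hCK_EK : CK • ((V.map φ).baseChange k⸨X⸩) = kubertThree (ι a₁') (ι a₃') := by
    rw [hCK, WeierstrassCurve.baseChange, WeierstrassCurve.map_variableChange, hC₀E, map_kubertThree]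
  -- §c the formal points `Q = P(s)` and `P = P(D) = 3 • Q`
  have hPQ : (V.map φ).laurentPt D hD0 = 3 • (V.map φ).laurentPt s hs0 :=
    WeierstrassCurve.laurentPt_formalMul V φ h2 3 hs0
  rw [laurentPt_of_ne_zero hs0 hs, laurentPt_of_ne_zero hD0 hD] at hPQ
  have hPQ' := congrArg (fun P => Affine.Point.congrEquiv hCK_EK (VariableChange.pointEquiv _ CK P)) hPQ
  simp only [map_nsmul, VariableChange.pointEquiv_some, Affine.Point.congrEquiv_some] at hPQ'
  -- §d coordinates of `Q″ = C_K(P(s))` and `P″ = C_K(P(D))`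
  have hιC : ∀ a : k, ι a = ((C a : k⟦X⟧) : k⸨X⸩) := fun a => rfl
  have hCKu : ((CK.u⁻¹ : k⸨X⸩ˣ) : k⸨X⸩) = ι μ := by
    change (((Units.map (ι : k →* k⸨X⸩) uμ)⁻¹ : k⸨X⸩ˣ) : k⸨X⸩) = ι μ
    rw [← map_inv, Units.coe_map, huinv]; rfl
  have htoX : ∀ x : k⸨X⸩, CK.toX x = ι μ ^ 2 * (x - ι X₁) := fun x => by
    rw [VariableChange.toX_def, hCKu]; rfl
  have htoY : ∀ x y : k⸨X⸩, CK.toY x y = ι μ ^ 3 * (y - ι lam * (x - ι X₁) - ι Y₁) := fun x y => by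
    rw [VariableChange.toY_def, hCKu]; rfl
  have hμK : ι μ ≠ 0 := (map_ne_zero ι).mpr hμ0
  obtain ⟨hQ'', hP'', hPQ''⟩ : ∃ (hQ : (kubertThree (ι a₁') (ι a₃')).toAffine.Nonsingular
      (CK.toX ((V.map φ).laurentX s))
      (CK.toY ((V.map φ).laurentX s) ((V.map φ).laurentY s)))
      (hP : (kubertThree (ι a₁') (ι a₃')).toAffine.Nonsingular
      (CK.toX ((V.map φ).laurentX D))
      (CK.toY ((V.map φ).laurentX D) ((V.map φ).laurentY D))),
      3 • Affine.Point.some _ _ hQ = Affine.Point.some _ _ hP := ⟨_, _, hPQ'.symm⟩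
  clear hPQ'
  have hsc := coe_laurent_ne_zero hs
  have hDc := coe_laurent_ne_zero hD
  have hψ₂Q : 2 * (V.map φ).laurentY s + ι (V.map φ).a₁ * (V.map φ).laurentX s + ι (V.map φ).a₃ ≠ 0 := by
    set Nser : k⟦X⟧ := -2 * (V.map φ).formalXMulSq.subst s +
      C (V.map φ).a₁ * s * (V.map φ).formalXMulSq.subst s + C (V.map φ).a₃ * s ^ 3 with hNser
    have hN0 : Nser ≠ 0 := by
      intro h0
      have h1 := congrArg constantCoeff h0
      simp only [hNser, map_add, map_mul, map_neg, map_pow, map_ofNat, constantCoeff_C, hs0,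
        constantCoeff_formalXMulSq_subst (E := V.map φ) hs0, map_zero] at h1
      norm_num at h1
      exact h2 h1
    have hNc := coe_laurent_ne_zero hN0
    have key : 2 * (V.map φ).laurentY s + ι (V.map φ).a₁ * (V.map φ).laurentX s + ι (V.map φ).a₃ =
        ((Nser : k⟦X⟧) : k⸨X⸩) / ((s : k⟦X⟧) : k⸨X⸩) ^ 3 := by
      rw [laurentX, laurentY, hNser, hιC, hιC]
      simp only [PowerSeries.coe_add, PowerSeries.coe_pow, map_ofNat, map_neg, map_mul]
      field_simp
    rw [key]
    exact div_ne_zero hNc (pow_ne_zero 3 hsc)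
  have hu : 2 * CK.toY ((V.map φ).laurentX s) ((V.map φ).laurentY s) + ι a₁' * CK.toX ((V.map φ).laurentX s) + ι a₃' ≠ 0 := by
    have e : 2 * CK.toY ((V.map φ).laurentX s) ((V.map φ).laurentY s) + ι a₁' * CK.toX ((V.map φ).laurentX s) + ι a₃' =
        ι μ ^ 3 * (2 * (V.map φ).laurentY s + ι (V.map φ).a₁ * (V.map φ).laurentX s + ι (V.map φ).a₃) := by
      rw [htoX, htoY, ha₁', ha₃']
      simp only [map_mul, map_add, map_pow, map_ofNat]
      ring
    rw [e]
    exact mul_ne_zero (pow_ne_zero 3 hμK) hψ₂Q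
  -- §e the Kubert identity `y(3Q″)·Ψ₃(Q″)³ = G(Q″)³`
  have h2KK : (2 : k⸨X⸩) ≠ 0 := by
    rw [show (2 : k⸨X⸩) = ι 2 from (map_ofNat ι 2).symm]; exact (map_ne_zero ι).mpr h2
  obtain ⟨hy3, -⟩ := kubert_y_three_smul hQ'' h2KK hu hPQ''
  have hΨ3 : (kubertThree (ι a₁') (ι a₃')).Ψ₃.eval (CK.toX ((V.map φ).laurentX s)) ≠ 0 := by
    intro h0
    have e3 := (kubert_evalEval_ψ_two_three_four (a₁ := ι a₁') (a₃ := ι a₃')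
      (CK.toX ((V.map φ).laurentX s))
      (CK.toY ((V.map φ).laurentX s) ((V.map φ).laurentY s))).2.1
    have h30 : (3 : ℤ) • Affine.Point.some _ _ hQ'' = 0 :=
      (Affine.Point.zsmul_some_eq_zero_iff hQ'' 3).mpr (by rw [e3, h0])
    rw [show (3 : ℤ) • Affine.Point.some _ _ hQ'' = 3 • Affine.Point.some _ _ hQ'' from natCast_zsmul _ 3,
      hPQ''] at h30
    exact Affine.Point.some_ne_zero _ h30
  -- §f the series and the bridging identities in `K`
  set Xs_ := (V.map φ).formalXMulSq.subst s with hXs_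
  set XD_ := (V.map φ).formalXMulSq.subst D with hXD_
  set Tser : k⟦X⟧ := -XD_ - C Y₁ * D ^ 3 - C lam * (XD_ * D - C X₁ * D ^ 3) with hTser
  set Xpp : k⟦X⟧ := C μ ^ 2 * Xs_ - C μ * C (μ * X₁) * s ^ 2 with hXpp
  set Ypp : k⟦X⟧ := -(C μ ^ 3 * Xs_) - C (μ * lam) * s * Xpp - C μ ^ 2 * C (μ * Y₁) * s ^ 3 with hYpp
  set Dser : k⟦X⟧ := 3 * Xpp ^ 4 + C a₁' ^ 2 * Xpp ^ 3 * s ^ 2 + 3 * (C a₁' * C a₃') * Xpp ^ 2 * s ^ 4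
    + 3 * C a₃' ^ 2 * Xpp * s ^ 6 with hDser
  set Gser : k⟦X⟧ := Xpp ^ 3 * Ypp - 4 * C a₃' * Xpp ^ 3 * s ^ 3 - C a₁' * C a₃' * Xpp * Ypp * s ^ 4
    - C a₁' ^ 2 * C a₃' * Xpp ^ 2 * s ^ 5 - 2 * C a₃' ^ 2 * Ypp * s ^ 6 - 2 * C a₁' * C a₃' ^ 2 * Xpp * s ^ 7
    - C a₃' ^ 3 * s ^ 9 with hGser
  have ex : ((s : k⟦X⟧) : k⸨X⸩) ^ 2 * CK.toX ((V.map φ).laurentX s) = ((Xpp : k⟦X⟧) : k⸨X⸩) := by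
    rw [htoX, laurentX, hXpp, hιC, hιC]
    simp only [map_sub, map_mul, map_pow]
    field_simp
    ring
  have ey : ((s : k⟦X⟧) : k⸨X⸩) ^ 3 * CK.toY ((V.map φ).laurentX s) ((V.map φ).laurentY s) = ((Ypp : k⟦X⟧) : k⸨X⸩) := by
    rw [htoY, laurentX, laurentY, hYpp, hXpp, hιC, hιC, hιC, hιC]
    simp only [map_sub, map_neg, map_mul, map_pow]
    field_simp
    ring
  have eT : ((D : k⟦X⟧) : k⸨X⸩) ^ 3 * CK.toY ((V.map φ).laurentX D) ((V.map φ).laurentY D) =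
      ι μ ^ 3 * ((Tser : k⟦X⟧) : k⸨X⸩) := by
    rw [htoY, laurentX, laurentY, hTser, hιC, hιC, hιC, hιC]
    simp only [map_sub, map_neg, map_mul, map_pow]
    field_simp
    ring
  have ex' : CK.toX ((V.map φ).laurentX s) = ((Xpp : k⟦X⟧) : k⸨X⸩) / ((s : k⟦X⟧) : k⸨X⸩) ^ 2 := by
    rw [eq_div_iff (pow_ne_zero 2 hsc), mul_comm]; exact ex
  have ey' : CK.toY ((V.map φ).laurentX s) ((V.map φ).laurentY s) = ((Ypp : k⟦X⟧) : k⸨X⸩) / ((s : k⟦X⟧) : k⸨X⸩) ^ 3 := by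
    rw [eq_div_iff (pow_ne_zero 3 hsc), mul_comm]; exact ey
  have eD : ((Dser : k⟦X⟧) : k⸨X⸩) = ((s : k⟦X⟧) : k⸨X⸩) ^ 8 *
      (kubertThree (ι a₁') (ι a₃')).Ψ₃.eval (CK.toX ((V.map φ).laurentX s)) := by
    rw [kubert_Ψ₃_eval, ex', hDser, hιC, hιC]
    simp only [map_add, map_mul, map_pow, map_ofNat]
    field_simp
  have eG : ((Gser : k⟦X⟧) : k⸨X⸩) = ((s : k⟦X⟧) : k⸨X⸩) ^ 9 *
      (CK.toX ((V.map φ).laurentX s) ^ 3 * CK.toY ((V.map φ).laurentX s) ((V.map φ).laurentY s)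
        - 4 * ι a₃' * CK.toX ((V.map φ).laurentX s) ^ 3
        - ι a₁' * ι a₃' * CK.toX ((V.map φ).laurentX s) * CK.toY ((V.map φ).laurentX s) ((V.map φ).laurentY s)
        - ι a₁' ^ 2 * ι a₃' * CK.toX ((V.map φ).laurentX s) ^ 2
        - 2 * ι a₃' ^ 2 * CK.toY ((V.map φ).laurentX s) ((V.map φ).laurentY s)
        - 2 * ι a₁' * ι a₃' ^ 2 * CK.toX ((V.map φ).laurentX s) - ι a₃' ^ 3) := by
    rw [ex', ey', hGser, hιC, hιC]
    simp only [map_sub, map_mul, map_pow, map_ofNat]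
    field_simp
  -- §g the identity `Θ · (μ s 𝒟)³ = (D 𝒢)³` in `k⟦X⟧`
  have hmain : Tser * (C μ * s * Dser) ^ 3 = (D * Gser) ^ 3 := by
    apply HahnSeries.ofPowerSeries_injective (Γ := ℤ) (R := k)
    simp only [map_mul, map_pow]
    rw [eD, eG, ← hιC]
    linear_combination -(((s : k⟦X⟧) : k⸨X⸩) ^ 27 *
        ((kubertThree (ι a₁') (ι a₃')).Ψ₃.eval (CK.toX ((V.map φ).laurentX s))) ^ 3) * eT
      + (((D : k⟦X⟧) : k⸨X⸩) ^ 3 * ((s : k⟦X⟧) : k⸨X⸩) ^ 27) * hy3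
  -- §h integrality of the witnesses in `S⟦X⟧`
  have hss : HasSubst s := HasSubst.of_constantCoeff_zero' hs0
  have hDs : HasSubst D := HasSubst.of_constantCoeff_zero' hD0
  have hXMS : (V.map φ).formalXMulSq ∈ R := by
    rw [← map_formalXMulSq]; exact map_mem_rangeS S φ hφS _
  have hM3 : (V.map φ).formalMul 3 ∈ R := by
    rw [← map_formalMul]; exact map_mem_rangeS S φ hφS _
  have hXsint : Xs_ ∈ R := by rw [hXs_]; exact subst_mem_rangeS S hXMS hsint hss
  have hDint : D ∈ R := by rw [hDdef]; exact subst_mem_rangeS S hM3 hsint hss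
  have hXDint : XD_ ∈ R := by rw [hXD_]; exact subst_mem_rangeS S hXMS hDint hDs
  have hcμ : (C μ : k⟦X⟧) ∈ R := C_mem_rangeS S hμS
  have hcX : (C (μ * X₁) : k⟦X⟧) ∈ R := C_mem_rangeS S hmX
  have hcY : (C (μ * Y₁) : k⟦X⟧) ∈ R := C_mem_rangeS S hmY
  have hcL : (C (μ * lam) : k⟦X⟧) ∈ R := C_mem_rangeS S hmL
  have hca₁ : (C (V.map φ).a₁ : k⟦X⟧) ∈ R := C_mem_rangeS S (by rw [map_a₁]; exact hφS _)
  have hca₃ : (C (V.map φ).a₃ : k⟦X⟧) ∈ R := C_mem_rangeS S (by rw [map_a₃]; exact hφS _)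
  have h2i : (2 : k⟦X⟧) ∈ R := ofNat_mem R 2
  have h3i : (3 : k⟦X⟧) ∈ R := ofNat_mem R 3
  have h4i : (4 : k⟦X⟧) ∈ R := ofNat_mem R 4
  have hA1 : (C a₁' : k⟦X⟧) = C μ * C (V.map φ).a₁ + 2 * C (μ * lam) := by
    rw [ha₁']; simp only [map_mul, map_add, map_ofNat]; ring
  have hA1int : (C a₁' : k⟦X⟧) ∈ R := by
    rw [hA1]; exact R.add_mem (R.mul_mem hcμ hca₁) (R.mul_mem h2i hcL)
  have hA3 : (C a₃' : k⟦X⟧) = 2 * C μ ^ 2 * C (μ * Y₁) + C μ ^ 2 * C (V.map φ).a₁ * C (μ * X₁) + C μ ^ 3 * C (V.map φ).a₃ := by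
    rw [ha₃']; simp only [map_mul, map_add, map_pow, map_ofNat]; ring
  have hA3int : (C a₃' : k⟦X⟧) ∈ R := by
    rw [hA3]
    exact R.add_mem (R.add_mem (R.mul_mem (R.mul_mem h2i (R.pow_mem hcμ 2)) hcY)
      (R.mul_mem (R.mul_mem (R.pow_mem hcμ 2) hca₁) hcX)) (R.mul_mem (R.pow_mem hcμ 3) hca₃)
  have hXppint : Xpp ∈ R :=
    R.sub_mem (R.mul_mem (R.pow_mem hcμ 2) hXsint) (R.mul_mem (R.mul_mem hcμ hcX) (R.pow_mem hsint 2))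
  have hYppint : Ypp ∈ R :=
    R.sub_mem (R.sub_mem (R.neg_mem (R.mul_mem (R.pow_mem hcμ 3) hXsint)) (R.mul_mem (R.mul_mem hcL hsint) hXppint))
      (R.mul_mem (R.mul_mem (R.pow_mem hcμ 2) hcY) (R.pow_mem hsint 3))
  have hDserint : Dser ∈ R :=
    R.add_mem (R.add_mem (R.add_mem (R.mul_mem h3i (R.pow_mem hXppint 4))
      (R.mul_mem (R.mul_mem (R.pow_mem hA1int 2) (R.pow_mem hXppint 3)) (R.pow_mem hsint 2)))
      (R.mul_mem (R.mul_mem (R.mul_mem h3i (R.mul_mem hA1int hA3int)) (R.pow_mem hXppint 2)) (R.pow_mem hsint 4)))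
      (R.mul_mem (R.mul_mem (R.mul_mem h3i (R.pow_mem hA3int 2)) hXppint) (R.pow_mem hsint 6))
  have hGserint : Gser ∈ R :=
    R.sub_mem (R.sub_mem (R.sub_mem (R.sub_mem (R.sub_mem (R.sub_mem
      (R.mul_mem (R.pow_mem hXppint 3) hYppint)
      (R.mul_mem (R.mul_mem (R.mul_mem h4i hA3int) (R.pow_mem hXppint 3)) (R.pow_mem hsint 3)))
      (R.mul_mem (R.mul_mem (R.mul_mem (R.mul_mem hA1int hA3int) hXppint) hYppint) (R.pow_mem hsint 4)))
      (R.mul_mem (R.mul_mem (R.mul_mem (R.pow_mem hA1int 2) hA3int) (R.pow_mem hXppint 2)) (R.pow_mem hsint 5)))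
      (R.mul_mem (R.mul_mem (R.mul_mem h2i (R.pow_mem hA3int 2)) hYppint) (R.pow_mem hsint 6)))
      (R.mul_mem (R.mul_mem (R.mul_mem (R.mul_mem h2i hA1int) (R.pow_mem hA3int 2)) hXppint) (R.pow_mem hsint 7)))
      (R.mul_mem (R.pow_mem hA3int 3) (R.pow_mem hsint 9))
  have hBint : C μ * s * Dser ∈ R := R.mul_mem (R.mul_mem hcμ hsint) hDserint
  have hAint : D * Gser ∈ R := R.mul_mem hDint hGserint
  -- §i `B ≠ 0`
  have hDser0 : Dser ≠ 0 := by
    intro h0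
    have h1 : ((Dser : k⟦X⟧) : k⸨X⸩) = 0 := by rw [h0, map_zero]
    rw [eD] at h1
    exact (mul_ne_zero (pow_ne_zero 8 hsc) hΨ3) h1
  have hCμ0 : (C μ : k⟦X⟧) ≠ 0 := fun h0 => by
    have h1 := congrArg constantCoeff h0
    exact hμ0 (by rwa [constantCoeff_C, map_zero] at h1)
  refine ⟨D * Gser, C μ * s * Dser, hAint, hBint, mul_ne_zero (mul_ne_zero hCμ0 hs) hDser0, ?_⟩
  exact hmain

end Main

end Summit.BirchSwinnertonDyer.BirchSwinnertonDyer.Theorems.ManinLocalTwoThree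

end
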